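import Summits.KontsevichZagierPeriods.KontsevichZagierPeriods.Theses.HermiteRigidity
import Summits.KontsevichZagierPeriods.KontsevichZagierPeriods.Theorems.HermiteRigidityIslandComplementStrength
import Summits.KontsevichZagierPeriods.KontsevichZagierPeriods.Theorems.HermiteRigidityReductionRigidityPadeBoxIslandsAllWeights
import Literature.NumberTheory.Transcendental.PreBlochGroup

/-!
# Strategy census companion, cycle s1 — crux `ReductionRigidity` (stmt-KontsevichZagierPeriods-3407),
# route `KontsevichZagierPeriods/HermiteRigidity`

Strategist seat `planner-cstrat-stmt-KontsevichZagierPeriods-3407-s1-0`, 2026-08-16. Companion of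
`Cruxes/ReductionRigidity/STRATEGY-CENSUS.md` (cycle s1). Everything here is kernel-checked bookkeeping
for the census headings; nothing in this file lowers the strength of the open leaf `IslandComplement`
(stmt-15935), which is the kernel form of Conjecture 1 (`islandComplement_iff_kernelForm`, tree).

* §D `KernelOn`, `CrossRigid`, `kernelOn_sup_iff` — DECOMPOSITION BY SECTORS COSTS EXACTLY CROSS-RIGIDITY:
  the kernel form on `S ⊔ T` is equivalent to "equal values across `S` and `T` are move-equivalent", so a
  split of the crux along sectors always leaves a piece as strong as the kernel form on the join; only
  value-disjoint sectors split for free (`crossRigid_of_disjointValues`), and value-disjointness is a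
  transcendence statement.
* §S `PolylogRigidityNearZero`, `UniformPolylogIslands`, `uniformPolylogIslands_of` — the one STRENGTHENING
  with teeth, and what it strengthens: the ISLANDS (all weights at once, large level; Nikišin 1979 /
  David–Hirata-Kohno–Kawashima 2020 Thm 2.1 as a fact to vend), not the leaf.
* §T `BlochGroupRatTorsion`, `dehnSum`, `DilogSectorRat`, `DehnClosedReduces`, `RigidityTwoRat`,
  `dilogSectorKernel_of`, `reductionRigidity_of_dilogLine` — the TRANSFER with teeth (Zagier's conjecture is
  a THEOREM for the field ℚ in weight 2: the Bloch group of ℚ is torsion, Suslin 1991 Thm 5.2 +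
  `K₃(ℚ) = K₃(ℤ) = ℤ/48`), typed as the growth line `bloch-suslin-rational-dilog` (crux idea of this seat):
  REDUCTION of the whole rational dilogarithm sector to weight ≤ 1 is a theorem-candidate; RIGIDITY stays
  inlined and open; the remainder `DilogIslandComplement` is summit-strength (conceded, as every line here).
* §N `ZetaTwoOnAlternatingIsland` — the first element of the island complement (level `ν = 1`, the
  singular corner `ζ(2) = [□², 1/(1 − xy)]`) and why it is not a counterexample candidate (one squaring
  chart on the open square); typed as a support statement.

References: M. Kontsevich, D. Zagier, *Periods* (2001) §1.2 [KontsevichZagier2001]; A. A. Suslin, *K₃ of a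
field and the Bloch group* (1991) Thm 5.2 [Suslin1991]; R. Lee, R. H. Szczarba, Ann. Math. 104 (1976)
[LeeSzczarba1976]; C. Soulé in *Higher algebraic K-theory: an overview*, LNM 1491 (1992) §2.3
(`K₃(ℤ) = ℤ/48`, `K₃(𝒪_F) = K₃(F)`); J. L. Dupont, *Scissors congruences…* (2001) Thm 10.24 b) + Remark 2
[Dupont2001]; D. Zagier, *The dilogarithm function* (2007) Ch. I [Zagier2007Dilogarithm]; E. M. Nikišin,
Mat. Sb. 109 (1979) [Nikishin1979]; S. David, N. Hirata-Kohno, M. Kawashima (2020) Thm 2.1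
[DavidHirataKohnoKawashima2020].
-/

noncomputable section

-- crux-workfile namespace convention `Summit.<P>.<Sub>.Cruxes.<Crux>.<Slug>` (P = Sub for this summit)
set_option linter.dupNamespace false

namespace Summit.KontsevichZagierPeriods.KontsevichZagierPeriods.Cruxes.ReductionRigidity.StrategyS1

open Set MeasureTheory
open Literature.NumberTheory.Transcendental
open Literature.NumberTheory.Transcendental.KZ
open Summit.KontsevichZagierPeriods.KontsevichZagierPeriods.Theses.HermiteRigidity
  (ReductionRigidity IslandComplement PadeBoxIslands)

/-! ## §D  Decomposition by sectors costs exactly cross-rigidity -/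

/-- Conjecture 1 in kernel form ON A SECTOR `S ≤ FormalRep`: every element of `S` of value `0` is a
chain of moves. The crux/leaf is `KernelOn ⊤`. [cite: KontsevichZagier2001, §1.2] -/
def KernelOn (S : AddSubgroup FormalRep) : Prop :=
  ∀ c ∈ S, KZ.eval c = 0 → c ∈ KZ.relations

/-- Monotonicity: islands shrink for free. [folklore] -/
theorem kernelOn_mono {S T : AddSubgroup FormalRep} (h : S ≤ T) (hT : KernelOn T) : KernelOn S :=
  fun c hc h0 => hT c (h hc) h0

/-- The leaf: `KernelOn ⊤` is the kernel form of Conjecture 1. [cite: KontsevichZagier2001, §1.2] -/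
theorem kernelOn_top_iff :
    KernelOn ⊤ ↔ ∀ c : FormalRep, KZ.eval c = 0 → c ∈ KZ.relations :=
  ⟨fun h c => h c (AddSubgroup.mem_top c), fun h c _ => h c⟩

/-- CROSS-RIGIDITY MODULO MOVES between two sectors: equal values across `S` and `T` are
move-equivalent. [cite: KontsevichZagier2001, §1.2] -/
def CrossRigid (S T : AddSubgroup FormalRep) : Prop :=
  ∀ s ∈ S, ∀ t ∈ T, KZ.eval s = KZ.eval t → s - t ∈ KZ.relations

/-- **Sector additivity costs exactly cross-rigidity**: the kernel form on the join of two sectors is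
EQUIVALENT to cross-rigidity between them (in particular it contains the kernel form on each). So every
decomposition of the leaf "by sectors" `⊤ = S₁ ⊔ … ⊔ S_k` has, besides the islands `KernelOn Sᵢ`, a piece
`CrossRigid` which is the kernel form on the join again. [cite: KontsevichZagier2001, §1.2] -/
theorem kernelOn_sup_iff (S T : AddSubgroup FormalRep) : KernelOn (S ⊔ T) ↔ CrossRigid S T := by
  constructor
  · intro h s hs t ht hst
    refine h (s - t) (sub_mem (AddSubgroup.mem_sup_left hs) (AddSubgroup.mem_sup_right ht)) ?_
    rw [map_sub, hst, sub_self]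
  · intro h c hc h0
    obtain ⟨s, hs, t, ht, rfl⟩ := AddSubgroup.mem_sup.1 hc
    have hst : KZ.eval s = KZ.eval (-t) := by
      rw [map_add] at h0
      rw [map_neg]
      linarith
    have := h s hs (-t) (neg_mem ht) hst
    simpa [sub_neg_eq_add] using this

/-- The islands are the diagonal part of cross-rigidity. [cite: KontsevichZagier2001, §1.2] -/
theorem kernelOn_of_crossRigid_left {S T : AddSubgroup FormalRep} (h : CrossRigid S T) : KernelOn S :=
  kernelOn_mono le_sup_left ((kernelOn_sup_iff S T).2 h)

/-- … and symmetrically. [cite: KontsevichZagier2001, §1.2] -/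
theorem kernelOn_of_crossRigid_right {S T : AddSubgroup FormalRep} (h : CrossRigid S T) : KernelOn T :=
  kernelOn_mono le_sup_right ((kernelOn_sup_iff S T).2 h)

/-- **The only free split**: two islands whose VALUE GROUPS meet trivially (a transcendence statement:
no non-zero value of `S` is a value of `T`) glue to an island on the join. This is the exact price list of
a sector decomposition of the leaf: islands + pairwise value-disjointness (rigidity ACROSS sectors) +
generation. [cite: KontsevichZagier2001, §1.2] -/
theorem crossRigid_of_disjointValues {S T : AddSubgroup FormalRep} (hS : KernelOn S) (hT : KernelOn T)
    (h : ∀ s ∈ S, ∀ t ∈ T, KZ.eval s = KZ.eval t → KZ.eval s = 0) : CrossRigid S T := by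
  intro s hs t ht hst
  have hs0 : KZ.eval s = 0 := h s hs t ht hst
  have ht0 : KZ.eval t = 0 := by rw [← hst, hs0]
  exact sub_mem (hS s hs hs0) (hT t ht ht0)

/-- Corollary: value-disjoint islands join. [cite: KontsevichZagier2001, §1.2] -/
theorem kernelOn_sup_of_disjointValues {S T : AddSubgroup FormalRep} (hS : KernelOn S) (hT : KernelOn T)
    (h : ∀ s ∈ S, ∀ t ∈ T, KZ.eval s = KZ.eval t → KZ.eval s = 0) : KernelOn (S ⊔ T) :=
  (kernelOn_sup_iff S T).2 (crossRigid_of_disjointValues hS hT h)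

/-! ## §S  The strengthening with teeth strengthens the ISLANDS, not the leaf -/

/-- `S⁺₉` input, typed exactly as the lead's island theorem `stub_padeBoxKernelGen` consumes it:
**rigidity near zero, uniformly in the weight** — for every `w` there is `N₀(w)` such that for all integer
levels `N ≥ N₀` the `w + 1` numbers `∫_□ⁱ dx/(N − x₀⋯x_{i−1})` (`= 1/(N−1), Li₁(1/N), …, Li_w(1/N)`) are
ℚ-linearly independent. A THEOREM in print (Nikišin 1979; David–Hirata-Kohno–Kawashima 2020 Thm 2.1 with
`log N > w²(1 + log(5/2)) + w log 3`), to be vended as a Literature fact; proved in the tree for `w = 1`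
(Baker) and `w = 2`, `N ≥ 10¹⁵` (`stub_dilogRigidity`). [cite: Nikishin1979] [cite: DavidHirataKohnoKawashima2020, Thm 2.1] -/
def PolylogRigidityNearZero : Prop :=
  ∀ w : ℕ, ∃ N₀ : ℕ, ∀ N : ℕ, N₀ ≤ N →
    ∀ β : ℕ → ℚ, (∑ i ∈ Finset.range (w + 1), (β i : ℝ) * ∫ p in cube i, 1 / ((N : ℝ) - ∏ l, p l)) = 0 →
      ∀ i ∈ Finset.range (w + 1), β i = 0

/-- The box generators of weight `≤ w` at integer level `N` (the lead's syntax, verbatim from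
`stub_padeBoxKernelGen`). [cite: KontsevichZagier2001, §1.2] -/
def boxGenSet (w N : ℕ) : Set FormalRep :=
  {c | ∃ (j : ℕ) (r : IntegralRep j) (a : Fin j → ℕ) (m : ℕ), j ≤ w ∧ r.domain = cube j ∧
      EqOn r.integrand (fun p => (∏ l, p l ^ a l) / ((N : ℝ) - ∏ l, p l) ^ m) (cube j) ∧ c = KZ.of r}

/-- `S⁺₉` conclusion: **the Padé box islands in EVERY weight, unconditionally, for every large level**.
[cite: KontsevichZagier2001, §1.2] -/
def UniformPolylogIslands : Prop :=
  ∀ w : ℕ, ∃ N₀ : ℕ, ∀ N : ℕ, N₀ ≤ N → KernelOn (AddSubgroup.closure (boxGenSet w N))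

/-- `S⁺₉` is one modus ponens away once the fact is vended: the lead's `stub_padeBoxKernelGen` does the
rest. What it buys for the LEAF: nothing (the complement of all box islands is untouched); what it buys for
the programme: all weights at once instead of one Padé construction per weight. [cite: Nikishin1979]
[cite: KontsevichZagier2001, §1.2] -/
theorem uniformPolylogIslands_of (h : PolylogRigidityNearZero) : UniformPolylogIslands := by
  intro w
  obtain ⟨N₀, hN₀⟩ := h w
  refine ⟨max N₀ 2, fun N hN c hc h0 => ?_⟩
  exact Summit.KontsevichZagierPeriods.HermiteRigidity.ReductionRigidity.stub_padeBoxKernelGen w N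
    (le_trans (le_max_right _ _) hN) (hN₀ N (le_trans (le_max_left _ _) hN)) c hc h0

/-! ## §T  The transfer with teeth: Zagier's conjecture is a theorem for ℚ in weight two
(Bloch–Suslin + `K₃(ℚ)` finite) — REDUCTION of the rational dilogarithm sector -/

/-- The Dehn / Bloch symbol of a formal combination of generators of `P(ℚ)`, paired against `u ∧ v` for
two additive characters `u, v : ℚˣ → ℚ` (this reads off every coordinate of `Σ nᵢ xᵢ ∧ (1 − xᵢ)` in the
ℚ-vector space `Λ²(ℚˣ) ⊗ ℚ`, cf. the rendering of Dupont's condition (i) in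
`PreBlochRelationCriterion`). [cite: Dupont2001, Thm 8.19] -/
def dehnPair (u v : Additive ℚˣ →+ ℚ) : FreeAbelianGroup (PreBloch.Gen ℚ) →+ ℚ :=
  FreeAbelianGroup.lift fun z =>
    u (Additive.ofMul (Units.mk0 z.1 z.2.1)) *
        v (Additive.ofMul (Units.mk0 (1 - z.1) (sub_ne_zero.2 z.2.2.symm))) -
      v (Additive.ofMul (Units.mk0 z.1 z.2.1)) *
        u (Additive.ofMul (Units.mk0 (1 - z.1) (sub_ne_zero.2 z.2.2.symm)))

/-- **NAMED-FACT CANDIDATE `BlochGroupRatTorsion`: the Bloch group of `ℚ` is a torsion group**, in the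
tree's presentation `PreBloch ℚ` (Neumann five-term relators): an integer combination of generators
`[x]`, `x ∈ ℚ ∖ {0,1}`, whose Bloch symbol vanishes in `Λ²(ℚˣ) ⊗ ℚ` has a positive multiple in the
subgroup generated by the RATIONAL five-term relators. Source chain: Suslin 1991 Thm 5.2
(`K₃^ind(F) ↠ B(F)` with finite kernel, `B(F) = ker(P(F) → (F^× ⊗ F^×)_σ)`, any infinite field) and
`K₃(ℚ) = K₃(ℤ) = ℤ/48` (Lee–Szczarba 1976; `K₃(𝒪_F) = K₃(F)`, Soulé's survey §2.3); equivalently Borel's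
rank computation. (For real-ALGEBRAIC arguments with all conjugates real the same holds in `𝒫_ℝ` modulo
torsion: Dupont 2001 Thm 10.24 b) + Remark 2 — held, read.) [cite: Suslin1991, Thm 5.2]
[cite: LeeSzczarba1976] [cite: Dupont2001, Thm 10.24 b) and Remark 2] -/
def BlochGroupRatTorsion : Prop :=
  ∀ ξ : FreeAbelianGroup (PreBloch.Gen ℚ), (∀ u v : Additive ℚˣ →+ ℚ, dehnPair u v ξ = 0) →
    ∃ M : ℕ, 0 < M ∧ M • ξ ∈ AddSubgroup.closure (fiveTermRelators ℚ)

/-- The level box IS the dilogarithm symbol: `1/(ν − a) = (1/ν)/(1 − (1/ν)·a)`; so the lead's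
`[□², 1/(ν − p₀p₁)]` (value `Li₂(1/ν)`) is literally `[□², x/(1 − x p₀p₁)]` with `x = 1/ν`, and
`ν > 1 ∨ ν < 0` is `x < 1 ∧ x ≠ 0`. [folklore] -/
theorem level_box_integrand (ν a : ℝ) (hν : ν ≠ 0) :
    1 / (ν - a) = (1 / ν) / (1 - (1 / ν) * a) := by
  by_cases h : ν - a = 0
  · have : a = ν := by linarith
    subst this
    simp [hν]
  · field_simp

/-- The dilogarithm symbols over ℚ: `[□², x/(1 − x p₀ p₁)]`, `x ∈ ℚ`, `x < 1`, `x ≠ 0` (value `Li₂(x)`;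
the five-term stub `stub_boxFiveTerm` is stated in exactly this syntax). [cite: Zagier2007Dilogarithm, Ch. I §1] -/
def dilogSymbols : Set FormalRep :=
  {c | ∃ (x : ℚ) (r : IntegralRep 2), x < 1 ∧ x ≠ 0 ∧ r.domain = cube 2 ∧
      EqOn r.integrand (fun p => (x : ℝ) / (1 - (x : ℝ) * p 0 * p 1)) (cube 2) ∧ c = KZ.of r}

/-- The weight-`≤ 1` carriers of the sector: Fubini products of two logarithm slabs
(`Li₁(x)Li₁(y)`), logarithm slabs (`Li₁(x) = −log(1−x)`), the regular alternating box
`[□², 1/(1 + p₀p₁)]` (value `ζ(2)/2`, the carrier of the five-term / Euler constants) and the rational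
constants. [cite: Zagier2007Dilogarithm, Ch. I §2] -/
def weightLeOneGens : Set FormalRep :=
  {c | ∃ (x y : ℚ) (r : IntegralRep 2), x < 1 ∧ x ≠ 0 ∧ y < 1 ∧ y ≠ 0 ∧ r.domain = cube 2 ∧
      EqOn r.integrand (fun p => (x : ℝ) * y / ((1 - (x : ℝ) * p 0) * (1 - (y : ℝ) * p 1))) (cube 2) ∧
      c = KZ.of r} ∪
  {c | ∃ (x : ℚ) (r : IntegralRep 1), x < 1 ∧ x ≠ 0 ∧ r.domain = cube 1 ∧
      EqOn r.integrand (fun p => (x : ℝ) / (1 - (x : ℝ) * p 0)) (cube 1) ∧ c = KZ.of r} ∪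
  {c | ∃ (r : IntegralRep 2), r.domain = cube 2 ∧
      EqOn r.integrand (fun p => 1 / (1 + p 0 * p 1)) (cube 2) ∧ c = KZ.of r} ∪
  {c | ∃ (r : IntegralRep 0) (q : ℚ), r.domain = cube 0 ∧
      EqOn r.integrand (fun _ => (q : ℝ)) (cube 0) ∧ c = KZ.of r}

/-- The weight-`≤ 1` carrier sector. [cite: KontsevichZagier2001, §1.2] -/
def WeightLeOneSector : AddSubgroup FormalRep := AddSubgroup.closure weightLeOneGens

/-- **The rational dilogarithm sector** `D₂(ℚ)`: all dilogarithm symbols at rational arguments (all levels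
`ν ∈ ℚ`, `ν > 1 ∨ ν < 0`, at once) together with the weight-`≤ 1` carriers. It contains every
`(2, 1/N)` box island's normal forms and every cross-level relation of the archipelago (duplication, Landen,
five-term, the pilot's `E₁, E₂, E₃`). [cite: KontsevichZagier2001, §1.2] [cite: Zagier2007Dilogarithm, Ch. I §2] -/
def DilogSectorRat : AddSubgroup FormalRep := AddSubgroup.closure (dilogSymbols ∪ weightLeOneGens)

/-- The Bloch symbol of the data `(xᵢ, nᵢ)` paired against `u ∧ v` (same functional as `dehnPair`, on
explicit finite data). [cite: Dupont2001, Thm 8.19] -/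
def dehnSum (k : ℕ) (x : Fin k → ℚ) (n : Fin k → ℤ) (hx : ∀ i, x i < 1 ∧ x i ≠ 0)
    (u v : Additive ℚˣ →+ ℚ) : ℚ :=
  ∑ i, (n i : ℚ) *
    (u (Additive.ofMul (Units.mk0 (x i) (hx i).2)) *
        v (Additive.ofMul (Units.mk0 (1 - x i) (sub_pos.2 (hx i).1).ne')) -
      v (Additive.ofMul (Units.mk0 (x i) (hx i).2)) *
        u (Additive.ofMul (Units.mk0 (1 - x i) (sub_pos.2 (hx i).1).ne')))

/-- Representations of the symbols `[xᵢ]` on the closed square. [cite: Zagier2007Dilogarithm, Ch. I §1] -/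
def IsSymbolFamily (k : ℕ) (x : Fin k → ℚ) (r : Fin k → IntegralRep 2) : Prop :=
  ∀ i, (r i).domain = cube 2 ∧
    EqOn (r i).integrand (fun p => (x i : ℝ) / (1 - (x i : ℝ) * p 0 * p 1)) (cube 2)

/-- **CORE STUB of the line (REDUCTION in weight two over ℚ)**: an integer combination of rational
dilogarithm symbols with VANISHING BLOCH SYMBOL is congruent, modulo `KZ.relations`, to a weight-`≤ 1`
element. Mechanism: `BlochGroupRatTorsion` gives `M·ξ ∈ ⟨rational five-term relators⟩`; a cyclic-order
lemma rewrites each rational Neumann relator as a Rogers/Abel instance with arguments in `(0,1)` plus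
Euler reflections and Landen inversions; these three families are KZ move chains (`stub_boxFiveTerm`
LANDED, `stub_boxLanden` landed at `z = 1/N`, Euler/reflection via `stub_reflectAt`), each leaving exactly
weight-`≤ 1` carriers; torsion is removed by `nsmul_mem_relations_iff` (tree). [cite: Suslin1991, Thm 5.2]
[cite: Zagier2007Dilogarithm, Ch. I §2] [cite: KontsevichZagier2001, §1.2] -/
def DehnClosedReduces : Prop :=
  ∀ (k : ℕ) (x : Fin k → ℚ) (n : Fin k → ℤ) (r : Fin k → IntegralRep 2) (hx : ∀ i, x i < 1 ∧ x i ≠ 0),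
    IsSymbolFamily k x r → (∀ u v : Additive ℚˣ →+ ℚ, dehnSum k x n hx u v = 0) →
      ∃ w ∈ WeightLeOneSector, (∑ i, n i • KZ.of (r i)) - w ∈ KZ.relations

/-- **INLINED RIGIDITY of the sector** (OPEN — the weight-two part of the period conjecture for ℚ, in
the exact form the island consumes; named, not attacked, as `PadeBoxIslands` inlines Viola–Zudilin and the
elliptic cruxes inline Masser): (a) a vanishing value of "dilogarithmic part + weight-≤1 part" forces the
Bloch symbol of the dilogarithmic part to vanish; (b) the kernel form on the weight-`≤ 1` carrier sector
(`1, ζ(2), log p, log p·log q`: quadratic independence of logarithms of primes — open beyond the diagonal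
cases that Baker gives). [cite: Zagier2007Dilogarithm, Ch. I §5] [cite: KontsevichZagier2001, §1.2] -/
def RigidityTwoRat : Prop :=
  (∀ (k : ℕ) (x : Fin k → ℚ) (n : Fin k → ℤ) (r : Fin k → IntegralRep 2) (hx : ∀ i, x i < 1 ∧ x i ≠ 0),
      IsSymbolFamily k x r → ∀ w ∈ WeightLeOneSector,
        KZ.eval ((∑ i, n i • KZ.of (r i)) - w) = 0 → ∀ u v : Additive ℚˣ →+ ℚ, dehnSum k x n hx u v = 0) ∧
    KernelOn WeightLeOneSector

/-- Presentation of sector elements (routine bookkeeping stub: closure induction, merging equal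
arguments). [folklore] -/
def DilogSectorPresentation : Prop :=
  ∀ c ∈ DilogSectorRat, ∃ (k : ℕ) (x : Fin k → ℚ) (n : Fin k → ℤ) (r : Fin k → IntegralRep 2)
    (_hx : ∀ i, x i < 1 ∧ x i ≠ 0), IsSymbolFamily k x r ∧
      ∃ w ∈ WeightLeOneSector, c = (∑ i, n i • KZ.of (r i)) + w

/-- **THE ISLAND of the line: Conjecture 1 in kernel form on the whole rational dilogarithm sector**,
from the three stubs — reduction (K-theory + functional equations as moves), the inlined rigidity, and the
presentation. Kernel-checked assembly. [cite: KontsevichZagier2001, §1.2] [cite: Suslin1991, Thm 5.2] -/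
theorem dilogSectorKernel_of (hP : DilogSectorPresentation) (hR : DehnClosedReduces)
    (hrig : RigidityTwoRat) : KernelOn DilogSectorRat := by
  intro c hc h0
  obtain ⟨k, x, n, r, hx, hr, w, hw, rfl⟩ := hP c hc
  -- (a) rigidity: the Bloch symbol of the dilogarithmic part vanishes
  have hD : ∀ u v : Additive ℚˣ →+ ℚ, dehnSum k x n hx u v = 0 :=
    hrig.1 k x n r hx hr (-w) (neg_mem hw) (by simpa [sub_neg_eq_add] using h0)
  -- reduction: the dilogarithmic part is a weight-≤1 element modulo moves
  obtain ⟨w', hw', hrel⟩ := hR k x n r hx hr hD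
  -- (b) rigidity on the weight-≤1 sector
  have hval : KZ.eval (w' + w) = 0 := by
    have h1 : KZ.eval ((∑ i, n i • KZ.of (r i)) - w') = 0 := eval_eq_zero_of_mem_relations hrel
    rw [map_sub] at h1
    rw [map_add] at h0 ⊢
    linarith
  have hW : w' + w ∈ KZ.relations := hrig.2 (w' + w) (add_mem hw' hw) hval
  have : (∑ i, n i • KZ.of (r i)) + w = ((∑ i, n i • KZ.of (r i)) - w') + (w' + w) := by abel
  rw [this]
  exact add_mem hrel hW

/-- The line's REMAINDER (summit-strength, conceded exactly as `IslandComplement`): the rational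
dilogarithm island implies the kernel form. [cite: KontsevichZagier2001, §1.2] -/
def DilogIslandComplement : Prop :=
  KernelOn DilogSectorRat → ∀ c : FormalRep, KZ.eval c = 0 → c ∈ KZ.relations

/-- Honesty check: the remainder is implied by the kernel form outright (so it is summit-strength once
the island is a theorem, like `islandComplement_iff_kernelForm`). [cite: KontsevichZagier2001, §1.2] -/
theorem dilogIslandComplement_of_kernelForm
    (hK : ∀ c : FormalRep, KZ.eval c = 0 → c ∈ KZ.relations) : DilogIslandComplement :=
  fun _ => hK

/-- **Composition of the growth line to the crux BY NAME**: presentation → reduction → rigidity →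
remainder → `ReductionRigidity` (through the landed `reductionRigidityOfKernelForm_proof`, stmt-14406).
[cite: KontsevichZagier2001, §1.2] -/
theorem reductionRigidity_of_dilogLine (hP : DilogSectorPresentation) (hR : DehnClosedReduces)
    (hrig : RigidityTwoRat) (hC : DilogIslandComplement) : ReductionRigidity :=
  Summit.KontsevichZagierPeriods.HermiteRigidity.ReductionRigidityOfKernelForm.reductionRigidityOfKernelForm_proof
    (hC (dilogSectorKernel_of hP hR hrig))

/-- … and to the route's open leaf `IslandComplement` (stmt-15935). [cite: KontsevichZagier2001, §1.2] -/
theorem islandComplement_of_dilogLine (hP : DilogSectorPresentation) (hR : DehnClosedReduces)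
    (hrig : RigidityTwoRat) (hC : DilogIslandComplement) : IslandComplement :=
  Summit.KontsevichZagierPeriods.HermiteRigidity.IslandComplement.islandComplement_of_kernelForm
    (hC (dilogSectorKernel_of hP hR hrig))

/-! ## §N  The first element of the island complement is accessible (not a counterexample) -/

/-- `N7` typed as a support statement: the level-`1` singular corner `ζ(2) = [□², 1/(1 − p₀p₁)]`
(on NO island: every island has level `ν > 1` or `ν < 0`) is move-equivalent to the regular alternating
box `[□², 2/(1 + p₀p₁)]` — duplication at `M = 1` (the landed `stub_boxDuplication` needs `M ≥ 2`):
one squaring chart `(s,t) = (x², y²)` on the OPEN square (`|det| = 4xy`,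
`4xy/(1 − x²y²) = 2/(1 − xy) − 2/(1 + xy)`) plus null-set bookkeeping at the corner. [cite: KontsevichZagier2001, §1.2 rules (1),(2)]
[cite: Zagier2007Dilogarithm, Ch. I §2] -/
def ZetaTwoOnAlternatingIsland : Prop :=
  ∀ (r s : IntegralRep 2), r.domain = cube 2 →
    EqOn r.integrand (fun p => 1 / (1 - p 0 * p 1)) (cube 2 ∩ {p | p 0 * p 1 < 1}) →
    s.domain = cube 2 → EqOn s.integrand (fun p => 2 / (1 + p 0 * p 1)) (cube 2) →
      KZ.of r - KZ.of s ∈ KZ.relations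

end Summit.KontsevichZagierPeriods.KontsevichZagierPeriods.Cruxes.ReductionRigidity.StrategyS1

end
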